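import Literature.Probability.RandomPlanarGeometry.HexSAWRotSurfaceYcLimitAllY
import HarnessLib

/-!
# The radius of convergence of Beaton's rotated half-plane generating function is `1/μ(y)` for every `y > 0`

Topic `Literature/Probability/RandomPlanarGeometry` (rider on `HexSAWRotSurfaceYcLimitAllY.lean` — the limit `rotSurfaceMu y = lim C⁺_n(y)^{1/n}` for
every `y > 0` — over R1/R4's radius vocabulary `RotHalfPlaneBounded x y` (the box sums `C⁺_{T,L}(x,y)` are bounded) /
`rotHalfPlaneBounded_iff_summable` and R1/R3's `rotYcSet`, `hexRotSurfaceYc = sSup rotYcSet = y†`).  Source: N. R. Beaton, J. Phys. A 47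
(2014) 075003, arXiv:1210.0274v3, §1 (introduction: "The lattice-dependent value μ is known as the growth constant, and is the reciprocal of the
radius of convergence of the generating function") with §3.1 Proposition 7 (p. 11) and §3.3 (the radius `ρ(y)` of the half-plane
generating function); Glazman–Manolescu 2019, Definition 1.1 (the sup-radius form, DCS frame).

## What is proved (all PROVED; namespace `…SAW.HV`)

* `summable_rotHpCoeff_mul_pow` — `x μ_rot(y) < 1 ⇒ Σ_n C⁺_n(y) xⁿ < ∞`; `not_summable_rotHpCoeff_mul_pow` — `x μ_rot(y) > 1 ⇒` divergence;
* **`rotHalfPlaneBounded_iff_mul_rotSurfaceMu_lt_one`** — off the circle, `RotHalfPlaneBounded x y ↔ x · μ_rot(y) < 1`: the radius of the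
  rotated half-plane generating function in `x` is EXACTLY `1/μ_rot(y)`;
* **`mem_rotYcSet_iff_rotSurfaceMu_eq`** — `y ∈ rotYcSet ↔ μ_rot(y) = μ` (`0 < y`): R1's desorbed set IS `{μ(y) = μ}`, consistently with
  R3's `hexRotSurfaceYc = y†` and `rotSurfaceMu_eq_iff`.
LABEL: CONSOLIDATION (the radius/limit dictionary for Beaton's half-plane series, rotated frame).
-/

noncomputable section

open Finset Filter Function
open Literature.Probability.LatticeModels Literature.Probability.Percolation SimpleGraph
open _root_.Topology

namespace Literature.Probability.RandomPlanarGeometry.SAW.HV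

open HexBW.Arm

variable {y : ℝ}

/-- Inner side of the radius: **`x·μ_rot(y) < 1 ⇒ Σ_n C⁺_n(y) xⁿ < ∞`.** [cite: Beaton2014RotatedHoneycomb, §1 (arXiv v3, introduction: "μ … is the reciprocal of the radius of convergence") and Proposition 7 (p. 11)] -/
theorem summable_rotHpCoeff_mul_pow (hy : 0 < y) {x : ℝ} (hx : 0 ≤ x) (h : x * rotSurfaceMu y < 1) :
    Summable fun n => rotHpCoeff n y * x ^ n := by
  rcases hx.eq_or_lt with rfl | hx0
  · refine summable_of_ne_finset_zero (s := {0}) fun n hn => ?_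
    rw [Finset.mem_singleton] at hn
    simp [zero_pow hn]
  obtain ⟨q, hq1, hq2⟩ := exists_between h
  have hq0 : 0 < q := (mul_pos hx0 (rotSurfaceMu_pos y)).trans hq1
  have hμr : rotSurfaceMu y < q / x := by rwa [lt_div_iff₀ hx0, mul_comm]
  refine Summable.of_norm_bounded_eventually_nat (summable_geometric_of_lt_one hq0.le hq2) ?_
  filter_upwards [eventually_rotHpCoeff_le_pow hy hμr] with n hn
  rw [Real.norm_of_nonneg (mul_nonneg (rotHpCoeff_nonneg n hy.le) (pow_nonneg hx n))]
  calc rotHpCoeff n y * x ^ n ≤ (q / x) ^ n * x ^ n := mul_le_mul_of_nonneg_right hn (pow_nonneg hx n)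
    _ = q ^ n := by rw [← mul_pow, div_mul_cancel₀ q hx0.ne']

/-- Outer side of the radius: **`x·μ_rot(y) > 1 ⇒ Σ_n C⁺_n(y) xⁿ = ∞`** (the terms do not tend to `0`). [cite: Beaton2014RotatedHoneycomb, §1 (arXiv v3, introduction) and Proposition 7 (p. 11)] -/
theorem not_summable_rotHpCoeff_mul_pow (hy : 0 < y) {x : ℝ} (hx : 0 ≤ x) (h : 1 < x * rotSurfaceMu y) :
    ¬ Summable fun n => rotHpCoeff n y * x ^ n := by
  intro hs
  have hx0 : 0 < x := by
    rcases hx.eq_or_lt with rfl | hx0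
    · norm_num at h
    · exact hx0
  obtain ⟨q, hq1, hq2⟩ := exists_between h
  have hr : q / x < rotSurfaceMu y := by rwa [div_lt_iff₀ hx0, mul_comm]
  have hq0 : (0 : ℝ) ≤ q / x := div_nonneg (zero_le_one.trans hq1.le) hx
  have h1 : ∀ᶠ n : ℕ in atTop, (1 : ℝ) ≤ rotHpCoeff n y * x ^ n := by
    filter_upwards [rotGrowthGeRate_rotSurfaceMu hy (q / x) hq0 hr] with n hn
    calc (1 : ℝ) ≤ q ^ n := one_le_pow₀ hq1.le
      _ = (q / x) ^ n * x ^ n := by rw [← mul_pow, div_mul_cancel₀ q hx0.ne']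
      _ ≤ rotHpCoeff n y * x ^ n := mul_le_mul_of_nonneg_right hn (pow_nonneg hx n)
  have h2 : ∀ᶠ n : ℕ in atTop, rotHpCoeff n y * x ^ n < 1 := hs.tendsto_atTop_zero.eventually (gt_mem_nhds one_pos)
  obtain ⟨n, hn1, hn2⟩ := (h1.and h2).exists
  exact absurd hn2 (not_lt.2 hn1)

/-- **`ρ(y) = 1/μ_rot(y)` is the radius of the rotated half-plane generating function** in R1's radius form: off the circle `x·μ_rot(y) = 1`,
`RotHalfPlaneBounded x y ↔ x·μ_rot(y) < 1`. [cite: Beaton2014RotatedHoneycomb, §1 (arXiv v3, introduction) and Proposition 7 (p. 11); GlazmanManolescu2019, Definition 1.1 (arXiv v3 p. 5: the sup-radius form)] -/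
theorem rotHalfPlaneBounded_iff_mul_rotSurfaceMu_lt_one (hy : 0 < y) {x : ℝ} (hx : 0 ≤ x) (hne : x * rotSurfaceMu y ≠ 1) :
    RotHalfPlaneBounded x y ↔ x * rotSurfaceMu y < 1 := by
  rw [rotHalfPlaneBounded_iff_summable hx hy.le]
  rcases lt_or_gt_of_ne hne with h | h
  · exact ⟨fun _ => h, fun _ => summable_rotHpCoeff_mul_pow hy hx h⟩
  · exact ⟨fun hs => absurd hs (not_summable_rotHpCoeff_mul_pow hy hx h), fun h' => absurd (h.trans h') (lt_irrefl _)⟩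

/-- **R1's desorbed set is `{μ_rot(y) = μ}`**: for `y > 0`, `y ∈ rotYcSet ↔ rotSurfaceMu y = μ` (bounded for every `x < x_c = 1/μ` iff the
limit is `μ`). [cite: Beaton2014RotatedHoneycomb, Proposition 7 (arXiv v3 p. 11: "μ(y) = μ if y ≤ y_c, > μ if y > y_c") and Theorem 1 (p. 2)] -/
theorem mem_rotYcSet_iff_rotSurfaceMu_eq (hy : 0 < y) : y ∈ rotYcSet ↔ rotSurfaceMu y = hexConnectiveConstant := by
  rw [rotSurfaceMu_eq_iff hy]
  constructor
  · intro h; exact le_rotYdagger_of_mem rotHPAbove_holds h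
  · intro h
    rcases h.lt_or_eq with hlt | heq
    · exact mem_rotYcSet_of_lt rotHPBelow_holds hy hlt
    · -- at `y = y†`: bounded for every `x < x_c`, since `x μ_rot(y†) = x μ < x_c μ = 1`
      rw [heq]
      refine ⟨(zero_lt_one.trans one_lt_rotYdagger).le, fun x hx0 hxc => ?_⟩
      have hμ : rotSurfaceMu rotYdagger = hexConnectiveConstant := (rotSurfaceMu_eq_iff (hy.trans_le h)).2 le_rfl
      have hlt : x * rotSurfaceMu rotYdagger < 1 := by
        rw [hμ, hexConnectiveConstant_eq_inv]
        calc x * hexCriticalFugacity⁻¹ < hexCriticalFugacity * hexCriticalFugacity⁻¹ :=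
              mul_lt_mul_of_pos_right hxc (inv_pos.2 hexCriticalFugacity_pos_lt_one.1)
          _ = 1 := mul_inv_cancel₀ hexCriticalFugacity_pos_lt_one.1.ne'
      exact (rotHalfPlaneBounded_iff_mul_rotSurfaceMu_lt_one (hy.trans_le h) hx0.le hlt.ne).2 hlt

end Literature.Probability.RandomPlanarGeometry.SAW.HV
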